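import Summits.HodgeConjecture.HodgeConjecture.Theorems.HeckePrymWeilWeilTwelvefoldsSqrtMinus7WeilSignature
import Literature.AlgebraicGeometry.Motives.HyperbolicWeilType
import Literature.AlgebraicGeometry.Motives.RationalDegreeOneModelWeilType
import Literature.AlgebraicGeometry.Motives.AbelianVarietyCohomologyExteriorH1
import Literature.AlgebraicGeometry.HodgeTheory.ComplexConjugation
import HarnessLib

/-!
# Crux `HodgeAbelianVarieties` (stmt-HodgeConjecture-1333), line `prym-canonical-z3-split-seeds` — stub `stub_descend`, part II: the signature `(n, n)` of the rational degree-one model, every `d`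

Registered helper `stub_descend_weilSignatureOfModel` of the stub `stub_descend`, second of the files
discharging the partner-surface fact `exists_weilTypeSurface_prod_isHyperbolicWeilType_all` (see part I,
`…StubDescendPrymMultiplicity`). **The signature `(n, n)` of the rational degree-one model of a polarized
abelian variety of Weil type, for every `d ≥ 1`** (B. van Geemen, LNM 1594 (1994), Lemma 5.2 (2), (4),
(5)): the sibling route's `stub_weilSignatureOfModel`
(`Theorems/HeckePrymWeilWeilTwelvefoldsSqrtMinus7WeilSignature`, `d = 7`) with the scalar `7` replaced by
`d` throughout, in the exact shape `hPN` consumed by `Motives.exists_isotropic_blockVectors'`. The `d`-free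
linear algebra (`weilSig_exists_PN`, `weilSig_re_pos_sup`, `weilSig_piece_finrank`, coordinates
`weilSig_equivFun_map` / `weilSig_pairing_eq` / `weilSig_equivFun_conjClass` / `weilSig_matrix_sq`) is
imported from the sibling's helper files; van Geemen's Hermitian-form pieces, there written for `d = 7`,
are re-proved here for every `d` (`weilSigD_isotropic`, `weilSigD_piece`, `weilSigD_exists_Zp_Zn`).
No named fact is taken.
-/

-- every declaration of this problem lives in `Summit.HodgeConjecture.HodgeConjecture.…` (single-problem summit)
set_option linter.dupNamespace false

noncomputable section

open CategoryTheory Complex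
open scoped Matrix ComplexConjugate
open Literature.AlgebraicGeometry Literature.AlgebraicGeometry.Motives
  Literature.AlgebraicGeometry.HodgeTheory Literature.AlgebraicTopology.SingularHomology
open Summit.HodgeConjecture.HodgeConjecture.Theorems.WeilTwelvefoldsSqrtMinus7.AmnesicSecantSheaves

namespace Summit.HodgeConjecture.HodgeConjecture.Cruxes.HodgeAbelianVarieties.PrymCanonicalZ3SplitSeeds.Stubs.Descend

/-! ### Van Geemen's Hermitian form: the two definite pieces, every `d` -/

section Piece

variable {ι : Type*} [Fintype ι] {V W : Type*} [AddCommGroup V] [Module ℂ V] [AddCommGroup W] [Module ℂ W]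
variable (T : V →ₗ[ℂ] V) (Q : V →ₗ[ℂ] V →ₗ[ℂ] W) (κ : V → V) (β : V ≃ₗ[ℂ] (ι → ℂ))
  {MA GA : Matrix ι ι ℚ} {ω : W}

omit [Fintype ι] in
/-- Isotropy of the eigenspaces (van Geemen 5.2, proof of (4)): if `Q(T x, T y) = d Q(x, y)` (Weil
type, `d ≠ 0`) and `T x = ν x`, `T y = ν y` with `ν² = -d`, then `Q(x, y) = 0`.
[cite: vanGeemen1994HodgeAV, proof of Lemma 5.2 (4)] -/
theorem weilSigD_isotropic {dC : ℂ} (hd : dC ≠ 0) (hQT : ∀ x y, Q (T x) (T y) = dC • Q x y) {ν : ℂ}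
    (hν : ν * ν = -dC) {x y : V} (hx : T x = ν • x) (hy : T y = ν • y) : Q x y = 0 := by
  have h := hQT x y
  rw [hx, hy, map_smul, map_smul, LinearMap.smul_apply, smul_smul, hν] at h
  have h2 : (2 * dC) • Q x y = 0 := by
    have e : (2 * dC) • Q x y = dC • Q x y - (-dC) • Q x y := by rw [← sub_smul]; ring_nf
    rw [e, h, sub_self]
  rcases smul_eq_zero.1 h2 with h3 | h3
  · exact absurd h3 (mul_ne_zero two_ne_zero hd)
  · exact h3

/-- **Sign of `Re H` on the piece `Z_μ`**, every `d`: `μ² = -d`, `μ̄ = -μ`, `μ · i = m ∈ ℝ`, `m ≠ 0`;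
Hodge–Riemann `i Q(x, κ x) = (t ρ) ω`, `t > 0`, on `H^{1,0} ∖ 0`, `ρ ≠ 0`. Then
`m ρ · Re (z ⬝ C z̄) > 0` for `0 ≠ z ∈ β((V_μ ∩ H^{1,0}) ⊔ (V_{-μ} ∩ H^{0,1}))`, `C = G_A M_A`
(cross terms vanish by isotropy of `V_{±μ}`; `weilSig_re_pos_sup`). [cite: vanGeemen1994HodgeAV, proof of Lemma 5.2 (4)] -/
theorem weilSigD_piece {dC : ℂ} (hd : dC ≠ 0) (hω0 : ω ≠ 0)
    (hsymm : ((GA * MA).map (algebraMap ℚ ℂ)).transpose = (GA * MA).map (algebraMap ℚ ℂ))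
    (hQT : ∀ x y, Q (T x) (T y) = dC • Q x y)
    (hH : ∀ x y, Q x (T (κ y)) = (β x ⬝ᵥ (GA * MA).map (algebraMap ℚ ℂ) *ᵥ star (β y)) • ω)
    (hβκ : ∀ x, β (κ x) = star (β x)) (hTκ : ∀ x, T (κ x) = κ (T x))
    (hκs : ∀ (c : ℂ) (x : V), κ (c • x) = conj c • κ x)
    {μ : ℂ} (hμ7 : μ * μ = -dC) (hμc : conj μ = -μ) {m : ℝ} (hm0 : m ≠ 0) (hμI : μ * Complex.I = (m : ℂ))
    (H10 H01 : Submodule ℂ V) (hκ01 : ∀ x ∈ H01, κ x ∈ H10) {ρ : ℝ} (hρ0 : ρ ≠ 0)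
    (hHR : ∀ x ∈ H10, x ≠ 0 → ∃ t : ℝ, 0 < t ∧ Complex.I • Q x (κ x) = ((t : ℂ) * ρ) • ω) :
    ∀ z ∈ ((Module.End.eigenspace T μ ⊓ H10) ⊔ (Module.End.eigenspace T (-μ) ⊓ H01)).map
        (β : V →ₗ[ℂ] (ι → ℂ)),
      z ≠ 0 → 0 < m * ρ * (z ⬝ᵥ (GA * MA).map (algebraMap ℚ ℂ) *ᵥ star z).re := by
  set C := (GA * MA).map (algebraMap ℚ ℂ) with hC_def
  have hκeig : ∀ {ν : ℂ} {x : V}, T x = ν • x → T (κ x) = conj ν • κ x := fun hx => by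
    rw [hTκ, hx, hκs]
  have hneg7 : (-μ) * (-μ) = -dC := by rw [neg_mul_neg, hμ7]
  -- `H(x) = m t ρ` on `V_μ ∩ H^{1,0}`
  have hval : ∀ x ∈ Module.End.eigenspace T μ ⊓ H10, x ≠ 0 →
      ∃ t : ℝ, 0 < t ∧ β x ⬝ᵥ C *ᵥ star (β x) = ((m * t * ρ : ℝ) : ℂ) := by
    rintro x ⟨hxμ, hx10⟩ hx0
    obtain ⟨t, ht, hHRx⟩ := hHR x hx10 hx0
    refine ⟨t, ht, smul_left_injective ℂ hω0 ?_⟩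
    have hTκx : T (κ x) = (-μ) • κ x := by rw [hκeig (Module.End.mem_eigenspace_iff.1 hxμ), hμc]
    have e1 : Q x (κ x) = (-Complex.I * ((t : ℂ) * ρ)) • ω := by
      have e2 : Q x (κ x) = (-Complex.I) • (Complex.I • Q x (κ x)) := by
        rw [smul_smul, show -Complex.I * Complex.I = 1 by rw [neg_mul, Complex.I_mul_I, neg_neg], one_smul]
      rw [e2, hHRx, smul_smul]
    change (β x ⬝ᵥ C *ᵥ star (β x)) • ω = _
    rw [← hH, hTκx, map_smul, e1, smul_smul]
    congr 1
    push_cast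
    linear_combination ((t : ℂ) * ρ) * hμI
  -- the scaled symmetric matrix
  set C' : Matrix ι ι ℂ := ((m * ρ : ℝ) : ℂ) • C with hC'_def
  have hC' : C'.transpose = C' := by rw [hC'_def, Matrix.transpose_smul, hsymm]
  have hC'app : ∀ a c : ι → ℂ, a ⬝ᵥ C' *ᵥ c = ((m * ρ : ℝ) : ℂ) * (a ⬝ᵥ C *ᵥ c) := fun a c => by
    rw [hC'_def, Matrix.smul_mulVec, dotProduct_smul, smul_eq_mul]
  have key := weilSig_re_pos_sup β κ hβκ C' hC' (Module.End.eigenspace T μ ⊓ H10)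
    (Module.End.eigenspace T (-μ) ⊓ H01) ?_ ?_ ?_ ?_
  · intro z hz hz0
    have h := key z hz hz0
    rwa [hC'app, Complex.re_ofReal_mul] at h
  · -- `H > 0` on `X`
    intro x hx hx0
    obtain ⟨t, ht, hv⟩ := hval x hx hx0
    rw [hC'app, hv, ← Complex.ofReal_mul, Complex.ofReal_re,
      show m * ρ * (m * t * ρ) = m * m * (ρ * ρ) * t by ring]
    exact mul_pos (mul_pos (mul_self_pos.2 hm0) (mul_self_pos.2 hρ0)) ht
  · -- `κ Y ⊆ X`
    rintro y ⟨hyμ, hy01⟩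
    refine ⟨Module.End.mem_eigenspace_iff.2 ?_, hκ01 y hy01⟩
    rw [hκeig (Module.End.mem_eigenspace_iff.1 hyμ), map_neg, hμc, neg_neg]
  · -- `X ⊥ Y`
    rintro x ⟨hxμ, -⟩ y ⟨hyμ, -⟩
    rw [hC'app]
    refine mul_eq_zero_of_right _ (smul_left_injective ℂ hω0 ?_)
    change (β x ⬝ᵥ C *ᵥ star (β y)) • ω = (0 : ℂ) • ω
    have hTκy : T (κ y) = μ • κ y := by
      rw [hκeig (Module.End.mem_eigenspace_iff.1 hyμ), map_neg, hμc, neg_neg]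
    rw [← hH, hTκy, map_smul, weilSigD_isotropic T Q hd hQT hμ7 (Module.End.mem_eigenspace_iff.1 hxμ) hTκy,
      smul_zero, zero_smul]
  · -- `Y ⊥ X`
    rintro x ⟨hxμ, -⟩ y ⟨hyμ, -⟩
    rw [hC'app]
    refine mul_eq_zero_of_right _ (smul_left_injective ℂ hω0 ?_)
    change (β y ⬝ᵥ C *ᵥ star (β x)) • ω = (0 : ℂ) • ω
    have hTκx : T (κ x) = (-μ) • κ x := by rw [hκeig (Module.End.mem_eigenspace_iff.1 hxμ), hμc]
    rw [← hH, hTκx, map_smul, weilSigD_isotropic T Q hd hQT hneg7 (Module.End.mem_eigenspace_iff.1 hyμ) hTκx,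
      smul_zero, zero_smul]

end Piece

/-- **The two definite pieces of `H¹`, every `d ≥ 1`** (van Geemen 1994, proof of Lemma 5.2 (4): `H` is
definite of opposite signs on `Z₁ = V₊^{1,0} ⊕ V₋^{0,1}` and `Z₂ = V₋^{1,0} ⊕ V₊^{0,1}`, each of
dimension `2n`), stated for the eigenvalue `s = i√d`, `d : ℕ`, of `T = φ^*` (rational matrix `M_A`,
`M_A² = -d`), `Q` with rational Gram matrix `G_A` (`ω ≠ 0`), alternating of Weil type
`M_Aᵀ G_A M_A = d G_A`, `κ` a coordinatewise conjugation commuting with `T` and swapping the Hodge pieces,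
multiplicities `dim (V_{±s} ∩ H^{1,0}) = n`, and Hodge–Riemann `i Q(x, κ x) = (t ρ) ω`, `t > 0`, on
`H^{1,0} ∖ 0`: there are complex subspaces `Z₊`, `Z₋ ⊆ ℂ^ι` of dimension `≥ 2n` with
`Re (z ⬝ G_A M_A z̄) > 0` on `Z₊ ∖ 0` and `< 0` on `Z₋ ∖ 0`. [cite: vanGeemen1994HodgeAV, Lemma 5.2 (4)] -/
theorem weilSigD_exists_Zp_Zn {ι : Type*} [Fintype ι] [DecidableEq ι] {V W : Type*} [AddCommGroup V]
    [Module ℂ V] [Module.Finite ℂ V] [AddCommGroup W] [Module ℂ W] (T : V →ₗ[ℂ] V)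
    (Q : V →ₗ[ℂ] V →ₗ[ℂ] W) (κ : V → V) (β : V ≃ₗ[ℂ] (ι → ℂ)) {d : ℕ} {MA GA : Matrix ι ι ℚ} {ω : W}
    (hd : 0 < d) (hω0 : ω ≠ 0) (hMA : MA * MA = (-(d : ℚ)) • (1 : Matrix ι ι ℚ)) (hGA : GA.transpose = -GA)
    (hWt : MA.transpose * GA * MA = (d : ℚ) • GA)
    (hβT : ∀ x, β (T x) = (MA.map (algebraMap ℚ ℂ)).mulVec (β x))
    (hβQ : ∀ x y, Q x y = (β x ⬝ᵥ (GA.map (algebraMap ℚ ℂ)).mulVec (β y)) • ω)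
    (hβκ : ∀ x, β (κ x) = star (β x)) (hTκ : ∀ x, T (κ x) = κ (T x))
    (hκs : ∀ (c : ℂ) (x : V), κ (c • x) = (starRingEnd ℂ) c • κ x)
    (H10 H01 : Submodule ℂ V) (hκ01 : ∀ x ∈ H01, κ x ∈ H10) (hκ10 : ∀ x ∈ H10, κ x ∈ H01) {n : ℕ}
    (hVp : Module.finrank ℂ ↥(Module.End.eigenspace T (Complex.I * (Real.sqrt d : ℂ)) ⊓ H10) = n)
    (hVm : Module.finrank ℂ ↥(Module.End.eigenspace T (-(Complex.I * (Real.sqrt d : ℂ))) ⊓ H10) = n)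
    {ρ : ℝ} (hρ0 : ρ ≠ 0)
    (hHR : ∀ x ∈ H10, x ≠ 0 → ∃ t : ℝ, 0 < t ∧ Complex.I • Q x (κ x) = ((t : ℂ) * ρ) • ω) :
    ∃ Zp Zn : Submodule ℂ (ι → ℂ), 2 * n ≤ Module.finrank ℂ Zp ∧ 2 * n ≤ Module.finrank ℂ Zn ∧
      (∀ z ∈ Zp, z ≠ 0 → 0 < (z ⬝ᵥ ((GA * MA).map (algebraMap ℚ ℂ)).mulVec (star z)).re) ∧
      (∀ z ∈ Zn, z ≠ 0 → (z ⬝ᵥ ((GA * MA).map (algebraMap ℚ ℂ)).mulVec (star z)).re < 0) := by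
  -- arithmetic of `s = i√d = m i`, `m = √d`
  set m : ℝ := Real.sqrt d with hm_def
  have hm : 0 < m := Real.sqrt_pos.2 (by exact_mod_cast hd)
  have hm7 : m * m = d := Real.mul_self_sqrt (Nat.cast_nonneg _)
  set s : ℂ := Complex.I * (Real.sqrt d : ℂ) with hs_def
  have hs : s = (m : ℂ) * Complex.I := mul_comm _ _
  set dC : ℂ := ((d : ℚ) : ℂ) with hdC_def
  have hdQ : (0 : ℚ) < d := by exact_mod_cast hd
  have hdC0 : dC ≠ 0 := by rw [hdC_def]; exact_mod_cast hd.ne'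
  have hII : Complex.I * Complex.I = -1 := Complex.I_mul_I
  have hmm : (m : ℂ) * (m : ℂ) = dC := by
    rw [hdC_def, Rat.cast_natCast, ← Complex.ofReal_natCast, ← hm7, Complex.ofReal_mul]
  have hs7 : s * s = -dC := by
    rw [hs]
    linear_combination ((m : ℂ) * (m : ℂ)) * hII - hmm
  have hsc : (starRingEnd ℂ) s = -s := by
    rw [hs, map_mul, Complex.conj_ofReal, Complex.conj_I]
    ring
  have hnsc : (starRingEnd ℂ) (-s) = -(-s) := by rw [map_neg, hsc]
  have hns7 : (-s) * (-s) = -dC := by rw [neg_mul_neg, hs7]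
  have hsI : s * Complex.I = ((-m : ℝ) : ℂ) := by
    rw [hs]
    push_cast
    linear_combination (m : ℂ) * hII
  have hnsI : (-s) * Complex.I = (m : ℂ) := by
    rw [neg_mul, hsI]
    push_cast
    ring
  have hs0 : s ≠ 0 := by
    rw [hs]
    exact mul_ne_zero (by exact_mod_cast hm.ne') Complex.I_ne_zero
  -- matrix identities over `ℂ`
  set C := (GA * MA).map (algebraMap ℚ ℂ) with hC_def
  have hsymm : C.transpose = C := by
    have h1 : MA.transpose * GA = -(GA * MA) := by
      have h : MA.transpose * GA * MA * MA = (d : ℚ) • (GA * MA) := by rw [hWt, Matrix.smul_mul]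
      rw [Matrix.mul_assoc, hMA, Matrix.mul_smul, Matrix.mul_one] at h
      have h2 : (d : ℚ) • (MA.transpose * GA + GA * MA) = 0 := by
        rw [smul_add, ← h, neg_smul, add_neg_cancel]
      rcases smul_eq_zero.1 h2 with h3 | h3
      · exact absurd h3 hdQ.ne'
      · exact eq_neg_of_add_eq_zero_left h3
    have h2 : (GA * MA).transpose = GA * MA := by
      rw [Matrix.transpose_mul, hGA, Matrix.mul_neg, h1, neg_neg]
    rw [hC_def, ← Matrix.transpose_map, h2]
  have hQT : ∀ x y, Q (T x) (T y) = dC • Q x y := by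
    intro x y
    rw [hβQ, hβQ x y, hβT, hβT, smul_smul]
    congr 1
    have h := Matrix.toBilin'_comp (GA.map (algebraMap ℚ ℂ)) (MA.map (algebraMap ℚ ℂ)) (MA.map (algebraMap ℚ ℂ))
    rw [← Matrix.transpose_map, ← Matrix.map_mul, ← Matrix.map_mul, hWt] at h
    have h' := congrArg (fun B : LinearMap.BilinForm ℂ (ι → ℂ) => B (β x) (β y)) h
    simp only [LinearMap.BilinForm.comp_apply, Matrix.toLin'_apply, Matrix.toBilin'_apply'] at h'
    rw [h']
    have e : ((d : ℚ) • GA).map (algebraMap ℚ ℂ) = dC • GA.map (algebraMap ℚ ℂ) := by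
      ext i j
      simp [hdC_def]
    rw [e, Matrix.smul_mulVec, dotProduct_smul, smul_eq_mul]
  have hH : ∀ x y, Q x (T (κ y)) = (β x ⬝ᵥ C *ᵥ star (β y)) • ω := by
    intro x y
    rw [hβQ, hβT, hβκ, Matrix.mulVec_mulVec, ← Matrix.map_mul]
  -- the two pieces
  have hP1 := weilSigD_piece T Q κ β hdC0 hω0 hsymm hQT hH hβκ hTκ hκs hs7 hsc (neg_ne_zero.2 hm.ne') hsI
    H10 H01 hκ01 hρ0 hHR
  have hP2 := weilSigD_piece T Q κ β hdC0 hω0 hsymm hQT hH hβκ hTκ hκs hns7 hnsc hm.ne' hnsI H10 H01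
    hκ01 hρ0 hHR
  have hF1 := weilSig_piece_finrank T κ β hβκ hTκ hκs hs0 hsc H10 H01 hκ10 hVp
  have hF2 := weilSig_piece_finrank T κ β hβκ hTκ hκs (neg_ne_zero.2 hs0) hnsc H10 H01 hκ10 hVm
  rw [neg_neg] at hP2 hF2
  set Z1 := ((Module.End.eigenspace T s ⊓ H10) ⊔ (Module.End.eigenspace T (-s) ⊓ H01)).map
    (β : V →ₗ[ℂ] (ι → ℂ))
  set Z2 := ((Module.End.eigenspace T (-s) ⊓ H10) ⊔ (Module.End.eigenspace T s ⊓ H01)).map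
    (β : V →ₗ[ℂ] (ι → ℂ))
  have sgn : ∀ {a r : ℝ}, 0 < a * r → (0 < a → 0 < r) ∧ (a < 0 → r < 0) := fun {a r} h => by
    rcases pos_and_pos_or_neg_and_neg_of_mul_pos h with ⟨ha, hr⟩ | ⟨ha, hr⟩
    · exact ⟨fun _ => hr, fun ha' => absurd ha (not_lt.2 ha'.le)⟩
    · exact ⟨fun ha' => absurd ha' (not_lt.2 ha.le), fun _ => hr⟩
  rcases lt_or_gt_of_ne hρ0 with hρ | hρ
  · refine ⟨Z1, Z2, hF1, hF2, fun z hz hz0 => (sgn (hP1 z hz hz0)).1 (by nlinarith),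
      fun z hz hz0 => (sgn (hP2 z hz hz0)).2 (by nlinarith)⟩
  · refine ⟨Z2, Z1, hF2, hF1, fun z hz hz0 => (sgn (hP2 z hz hz0)).1 (by nlinarith),
      fun z hz hz0 => (sgn (hP1 z hz hz0)).2 (by nlinarith)⟩

/-! ### The registered helper: the signature of the rational degree-one model, every `d` -/

/-- **The signature `(n, n)` of the rational degree-one model, every `d ≥ 1`** (registered helper
`stub_descend_weilSignatureOfModel` of stmt-HodgeConjecture-1333; van Geemen, LNM 1594, Lemma 5.2
(4)–(5), on the carriers, in the EXACT shape `hPN` consumed by `Motives.exists_isotropic_blockVectors'`).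
Data: `(A, φ)` of dimension `2n`, `φ ≫ φ = -(d • 𝟙 A)`; a real Hodge model `M` on whose `H^{1,0}` the
eigenvalues `± i√d` of `φ^*` have multiplicity `n`; a rational `φ`-compatible class `h` (`φ^* h = d h`)
satisfying Hodge–Riemann in degree one (hypothesis; the tree's theorem `hodgeRiemann_degreeOne` supplies
it for hyperplane classes); a rational degree-one model `(u, M_A, ω, G_A)` of `(A, φ, h)`. Conclusion:
`S(v, w) = v ⬝ G_A (M_A w)` is positive definite on an `M_A`-stable rational `P` and negative definite on
an `M_A`-stable `N`, both of dimension `2n`, `P ⊓ N = 0`. Proof: `G_A` is alternating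
(`Motives.gram_antisymm`) and of Weil type (`Motives.gram_map_eq_mul_gram`, `H• = ⋀• H¹`), `(φ^*)² = -d`
on `H¹`, conjugation is coordinatewise in the rational basis, commutes with `φ^*` and swaps the pieces of
the real model; then `weilSigD_exists_Zp_Zn` and `weilSig_exists_PN`.
[cite: vanGeemen1994HodgeAV, Lemma 5.2 (2), (4), (5) with proof] -/
theorem stub_descend_weilSignatureOfModel :
    ∀ (n d : ℕ) (A : AbelianVariety ℂ) (φ : A ⟶ A), 0 < d → A.dim = 2 * n → φ ≫ φ = -(d • 𝟙 A) →
    ∀ (M : HodgeModel (2 * n) A.X), M.IsReal →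
      Module.finrank ℂ ↥(Module.End.eigenspace (complexBetti.map φ.hom.hom.hom 1).hom
            (Complex.I * (Real.sqrt d : ℂ)) ⊓ (M.hodgePQ 1 1 0).comap (M.pullback 1).hom) = n →
      Module.finrank ℂ ↥(Module.End.eigenspace (complexBetti.map φ.hom.hom.hom 1).hom
            (-(Complex.I * (Real.sqrt d : ℂ))) ⊓ (M.hodgePQ 1 1 0).comap (M.pullback 1).hom) = n →
    ∀ (h : complexBetti A.X 2), IsRationalClass h → complexBetti.map φ.hom.hom.hom 2 h = (d : ℂ) • h →
      (∃ ω₀ : complexBetti A.X (2 + 2 * (2 * n - 1)), IsRationalClass ω₀ ∧ ω₀ ≠ 0 ∧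
        ∀ x : complexBetti A.X 1, M.pullback 1 x ∈ M.hodgePQ 1 1 0 → x ≠ 0 →
          ∃ t : ℝ, 0 < t ∧
            Complex.I • polarizationPairingOne A.X h (2 * n - 1) x (conjClass (ComplexPoints A.X) 1 x) =
              (t : ℂ) • ω₀) →
    ∀ (ι : Type) [Fintype ι] [DecidableEq ι] (u : ι → complexBetti A.X 1),
      (∀ i, IsRationalClass (u i)) → LinearIndependent ℂ u → Submodule.span ℂ (Set.range u) = ⊤ →
    ∀ (MA : Matrix ι ι ℚ),
      (∀ i, complexBetti.map φ.hom.hom.hom 1 (u i) = ∑ j, ((MA j i : ℚ) : ℂ) • u j) →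
    ∀ (ω : complexBetti A.X (2 + 2 * (2 * n - 1))) (GA : Matrix ι ι ℚ), IsRationalClass ω → ω ≠ 0 →
      (∀ i j, polarizationPairingOne A.X h (2 * n - 1) (u i) (u j) = ((GA i j : ℚ) : ℂ) • ω) →
    ∃ P N : Submodule ℚ (ι → ℚ), (∀ v ∈ P, MA.mulVec v ∈ P) ∧ (∀ v ∈ N, MA.mulVec v ∈ N) ∧
      Module.finrank ℚ P = 2 * n ∧ Module.finrank ℚ N = 2 * n ∧ P ⊓ N = ⊥ ∧
      (∀ x ∈ P, x ≠ 0 → 0 < x ⬝ᵥ GA.mulVec (MA.mulVec x)) ∧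
      (∀ x ∈ N, x ≠ 0 → x ⬝ᵥ GA.mulVec (MA.mulVec x) < 0) := by
  intro n d A φ hd hA hφ M hM hVp hVm h _hh hφh hHR ι _ _ u hu hind hspan MA hMAu ω GA hω hω0 hG
  classical
  -- the degenerate case `n = 0`
  rcases Nat.eq_zero_or_pos n with hn0 | hn
  · subst hn0
    refine ⟨⊥, ⊥, fun v hv => ?_, fun v hv => ?_, by simp, by simp, by simp, fun x hx hx0 => ?_,
      fun x hx hx0 => ?_⟩
    · rw [(Submodule.mem_bot ℚ).1 hv, Matrix.mulVec_zero]; exact Submodule.zero_mem _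
    · rw [(Submodule.mem_bot ℚ).1 hv, Matrix.mulVec_zero]; exact Submodule.zero_mem _
    · exact absurd ((Submodule.mem_bot ℚ).1 hx) hx0
    · exact absurd ((Submodule.mem_bot ℚ).1 hx) hx0
  haveI : Module.Finite ℂ (complexBetti A.X 1) := finite_complexBetti_abelianVariety A 1
  set T : complexBetti A.X 1 →ₗ[ℂ] complexBetti A.X 1 := (complexBetti.map φ.hom.hom.hom 1).hom with hT_def
  set Q := polarizationPairingOne A.X h (2 * n - 1) with hQ_def
  set κ : complexBetti A.X 1 → complexBetti A.X 1 := conjClass (ComplexPoints A.X) 1 with hκ_def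
  set H10 : Submodule ℂ (complexBetti A.X 1) := (M.hodgePQ 1 1 0).comap (M.pullback 1).hom with hH10_def
  set H01 : Submodule ℂ (complexBetti A.X 1) := (M.hodgePQ 1 0 1).comap (M.pullback 1).hom with hH01_def
  -- the rational basis `u` and coordinates
  let b : Module.Basis ι ℂ (complexBetti A.X 1) := Module.Basis.mk hind hspan.ge
  have hbu : ⇑b = u := Module.Basis.coe_mk _ _
  set β : complexBetti A.X 1 ≃ₗ[ℂ] (ι → ℂ) := b.equivFun with hβ_def
  have hTb : ∀ i, T (b i) = ∑ j, ((MA j i : ℚ) : ℂ) • b j := fun i => by rw [hbu]; exact hMAu i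
  have hQb : ∀ i j, Q (b i) (b j) = ((GA i j : ℚ) : ℂ) • ω := fun i j => by rw [hbu]; exact hG i j
  have hbrat : ∀ i, IsRationalClass (b i) := fun i => by rw [hbu]; exact hu i
  have hβT : ∀ x, β (T x) = (MA.map (algebraMap ℚ ℂ)).mulVec (β x) := weilSig_equivFun_map b hTb
  have hβQ : ∀ x y, Q x y = (β x ⬝ᵥ (GA.map (algebraMap ℚ ℂ)).mulVec (β y)) • ω := weilSig_pairing_eq b hQb
  have hβκ : ∀ x, β (κ x) = star (β x) := weilSig_equivFun_conjClass b hbrat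
  -- `(φ^*)² = -d`, hence `M_A² = -d`
  have hTT : ∀ x, T (T x) = -((((d : ℚ)) : ℂ) • x) := fun x => by
    rw [Rat.cast_natCast]
    exact complexBetti_map_map_one_of_comp_self hφ x
  have hMA : MA * MA = (-(d : ℚ)) • (1 : Matrix ι ι ℚ) := weilSig_matrix_sq b hTb hTT
  -- `G_A` is alternating and of Weil type
  have hGA : GA.transpose = -GA := by
    ext i k
    rw [Matrix.transpose_apply, Matrix.neg_apply]
    exact gram_antisymm h (2 * n - 1) u hω0 GA hG k i
  have hA' : A.dim = 2 * n - 1 + 1 := by omega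
  have hWt : MA.transpose * GA * MA = (d : ℚ) • GA := by
    ext i k
    have e := gram_map_eq_mul_gram hA' (abelianVarietyCohomologyExteriorH1_holds.finrank_one A)
      (abelianVarietyCohomologyExteriorH1_holds.span_range_cupPowOne A _) hd hφ hφh u MA
      hMAu hω0 GA hG i k
    rw [Matrix.smul_apply, smul_eq_mul] at *
    rw [← e]
    simp only [Matrix.mul_apply, Matrix.transpose_apply, Finset.sum_mul]
    rw [Finset.sum_comm]
  -- conjugation: commutes with `φ^*`, is conjugate-linear, swaps the Hodge pieces of the real model
  have hTκ : ∀ x, T (κ x) = κ (T x) := fun x => (conjClass_map _ x).symm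
  have hκs : ∀ (c : ℂ) (x : complexBetti A.X 1), κ (c • x) = (starRingEnd ℂ) c • κ x :=
    fun c x => conjClass_smul c x
  have hκpq : ∀ (p q : ℕ) (x : complexBetti A.X 1), M.pullback 1 x ∈ M.hodgePQ 1 p q →
      M.pullback 1 (κ x) ∈ M.hodgePQ 1 q p := fun p q x hx => by
    rw [hκ_def, ← conjClass_map]
    exact hM.isHodgeSymmetric 1 p q _ hx
  have hκ01 : ∀ x ∈ H01, κ x ∈ H10 := fun x hx => hκpq 0 1 x hx
  have hκ10 : ∀ x ∈ H10, κ x ∈ H01 := fun x hx => hκpq 1 0 x hx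
  -- the Hodge–Riemann class `ω₀` is a real multiple `ρ ω` of `ω`
  obtain ⟨ω₀, hω₀rat, hω₀0, hHRω⟩ := hHR
  have hne : Module.End.eigenspace T (Complex.I * (Real.sqrt d : ℂ)) ⊓ H10 ≠ ⊥ := fun h0 => by
    rw [h0, finrank_bot] at hVp
    omega
  obtain ⟨x₀, hx₀, hx₀0⟩ := Submodule.exists_mem_ne_zero_of_ne_bot hne
  obtain ⟨t₀, ht₀, e₀⟩ := hHRω x₀ hx₀.2 hx₀0
  set ρc : ℂ := (t₀ : ℂ)⁻¹ * (Complex.I * (β x₀ ⬝ᵥ (GA.map (algebraMap ℚ ℂ)).mulVec (β (κ x₀)))) with hρc_def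
  have hω₀ : ω₀ = ρc • ω := by
    have ht0' : (t₀ : ℂ) ≠ 0 := by exact_mod_cast ht₀.ne'
    calc ω₀ = (t₀ : ℂ)⁻¹ • ((t₀ : ℂ) • ω₀) := by rw [smul_smul, inv_mul_cancel₀ ht0', one_smul]
      _ = ρc • ω := by rw [← e₀, hβQ, smul_smul, smul_smul, hρc_def, mul_assoc]
  have hρreal : (starRingEnd ℂ) ρc = ρc := by
    have h1 : conjClass (ComplexPoints A.X) _ ω₀ = ω₀ := hω₀rat.conjClass_eq
    rw [hω₀, conjClass_smul, hω.conjClass_eq] at h1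
    have h2 : ((starRingEnd ℂ) ρc - ρc) • ω = 0 := by rw [sub_smul, h1, sub_self]
    rcases smul_eq_zero.1 h2 with h3 | h3
    · exact sub_eq_zero.1 h3
    · exact absurd h3 hω0
  set ρ : ℝ := ρc.re with hρ_def
  have hρc : ρc = (ρ : ℂ) := (Complex.conj_eq_iff_re.1 hρreal).symm
  have hρ0 : ρ ≠ 0 := fun h0 => hω₀0 (by rw [hω₀, hρc, h0, Complex.ofReal_zero, zero_smul])
  have hHR' : ∀ x ∈ H10, x ≠ 0 → ∃ t : ℝ, 0 < t ∧ Complex.I • Q x (κ x) = ((t : ℂ) * ρ) • ω := by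
    intro x hx hx0
    obtain ⟨t, ht, e⟩ := hHRω x hx hx0
    exact ⟨t, ht, by rw [e, hω₀, hρc, smul_smul]⟩
  -- the two definite pieces and the rational definite subspaces
  have hdQ : (0 : ℚ) < d := by exact_mod_cast hd
  obtain ⟨Zp, Zn, hZp, hZn, hpos, hneg⟩ := weilSigD_exists_Zp_Zn T Q κ β hd hω0 hMA hGA hWt hβT hβQ hβκ
    hTκ hκs H10 H01 hκ01 hκ10 hVp hVm hρ0 hHR'
  exact weilSig_exists_PN hdQ hMA hGA hWt n Zp Zn hZp hZn hpos hneg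

end Summit.HodgeConjecture.HodgeConjecture.Cruxes.HodgeAbelianVarieties.PrymCanonicalZ3SplitSeeds.Stubs.Descend

end
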